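import Mathlib

/-!
# The inner connection problem of the large-swirl law is hypergeometric: `k₁ = 27/(32π)` (K31)

Solo seat `solo-NavierStokesRegularity-informed`, session 14; companion of `paper/axisymmetric-rigidity.md` §5h
(Prop. 8.25, Cor. 8.25′, Prop. 8.26). The thin-cone / inner system (S₀) in the variables `(u, V, s, p)(t)`,
  `V u' = s² - 2p - u - u²`, `t V' = -3ut - V`, `t V s' = -s(t + 2ut + V)`, `t p' = s²`,
has the exact solution `E₁ = (1, -3t/2, t, t²/2 - 1)` (K29). This file certifies the algebra of §5h:
* `innerConn_lin_R/_D/_A/_P`: the `η`-expansion of the four residuals of (S₀) on `E₁ + η·(a, e, c, d)` with derivative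
  values `η·(da, de, dc, dd)` — the linear coefficients are the linearised system, the rest is `O(η²)` and explicit;
* `innerConn_L`: in `(δu, δp, δS̃, δṼ) = (a, d, tc, te)` the linearised system is
  `δu' = (2/t)δu + (4/(3t))(δp - δS̃)`, `δp' = (2/t)δS̃`, `δS̃' = (4t/3)δu + (2/t)δS̃ + (4/(3t))δṼ`, `δṼ' = -3tδu`;
* `innerConn_elim₁/₂/_aux/_core`, `innerConn_E1_exact`: with `τ = t²`, `f = δṼ`, `g = δp`, `δu = -(2/3)f_τ`, `δS̃ = τ g_τ` the first and
  third equations (times `3t`, resp. `t/2`) are `-τ f_ττ + f_τ = g - τ g_τ = -τ²(f_τ/τ - g/τ)'` and `τ² g_ττ = -(4/9)τ f_τ + (2/3) f`; with `g = f_τ - C₁τ` this is the CORE equation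
  `τ² f''' + (4/9) τ f' - (2/3) f = 0`;
* `innerConn_recursion`, `innerConn_matching`: the algebraic formal solution `Σ aₙ τ^{3/2-n}`, `a₀ = 3/2`, has `a₁ = -81/64`,
  `a₂ = -2187/4096`, and `(4/3)a₁ = -27/16` is the coefficient `U₁ = -(27/16)η/ξ` of the outer slow manifold (§5f);
* `innerConn_osc_exponent`: the polynomial identity behind "the oscillatory solutions are `O(t⁰)`";
* `innerConn_MB_shift`, `innerConn_MB_halfshift`: the Gamma-function identities that make the Mellin–Barnes integral
  `G(x) = (1/2πi)∫ Γ(-s)Γ(1-s)Γ(2-s)Γ(s-3/2) x^s ds` solve `θ(θ-1)(θ-2)G = -x(θ-3/2)G`;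
* `innerConn_Gamma_neg_half`, `innerConn_Gamma_neg_three_halves`, `innerConn_residue_product`, `innerConn_residue_zero`:
  `Γ(-1/2) = -2√π`, `Γ(-3/2) = (4/3)√π`, `Γ(-3/2)Γ(-1/2)Γ(1/2) = -(8/3)π√π`, `Γ(1)Γ(2)Γ(-3/2) = (4/3)√π`;
* `innerConn_norm`, `innerConn_constant`: the normalisation `λ = -243/(128 π√π)` (so that `λ G(4τ/9) ~ (3/2)τ^{3/2} - (81/64)τ^{1/2}`)
  and the connection value `λ · (4/3)√π = -81/(32π)`, whence `k₁ = -(1/3)·(-81/(32π)) = 27/(32π)` and `4k₁ = 27/(8π)`.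
The Mellin–Barnes analysis itself (convergence, contour shifts, uniqueness of the non-oscillatory solution) is pen-and-paper
(Prop. 8.25); the derivatives enter as real variables constrained by the equations, as in K29/K30. No new definitions; axioms: standard.
-/

namespace Summit.NavierStokesRegularity.NavierStokesRegularity.Theorems

/-! ### Linearisation of (S₀) at `E₁` -/

/-- (R) `V u' = s² - 2p - u - u²` on `E₁ + η(a,e,c,d)`: residual `= η·L_R + η²·Q_R`, `L_R = -(3t/2)da - 2tc + 2d + 3a`. -/
theorem innerConn_lin_R (t η a e c d da : ℝ) :
    (-3 * t / 2 + η * e) * (η * da) - ((t + η * c) ^ 2 - 2 * (t ^ 2 / 2 - 1 + η * d) - (1 + η * a) - (1 + η * a) ^ 2)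
      = η * (-(3 * t / 2) * da - 2 * t * c + 2 * d + 3 * a) + η ^ 2 * (e * da - c ^ 2 + a ^ 2) := by
  ring

/-- (D) `t V' = -3ut - V` on `E₁ + η(a,e,c,d)`: residual `= η·(t·de + 3ta + e)` (exactly linear). -/
theorem innerConn_lin_D (t η a e de : ℝ) :
    t * (-3 / 2 + η * de) + 3 * (1 + η * a) * t + (-3 * t / 2 + η * e) = η * (t * de + 3 * t * a + e) := by
  ring

/-- (A) `t V s' = -s(t + 2ut + V)` on `E₁ + η(a,e,c,d)`: residual `= η·L_A + η²·Q_A`,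
`L_A = -(3t²/2)dc + 2te + 2t²a + (3t/2)c`. -/
theorem innerConn_lin_A (t η a e c dc : ℝ) :
    t * (-3 * t / 2 + η * e) * (1 + η * dc) + (t + η * c) * (t + 2 * (1 + η * a) * t + (-3 * t / 2 + η * e))
      = η * (-(3 * t ^ 2 / 2) * dc + 2 * t * e + 2 * t ^ 2 * a + 3 * t / 2 * c)
        + η ^ 2 * (t * e * dc + 2 * t * a * c + c * e) := by
  ring

/-- (P) `t p' = s²` on `E₁ + η(a,e,c,d)`: residual `= η·(t·dd - 2tc) - η²c²`. -/
theorem innerConn_lin_P (t η c dd : ℝ) :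
    t * (t + η * dd) - (t + η * c) ^ 2 = η * (t * dd - 2 * t * c) - η ^ 2 * c ^ 2 := by
  ring

/-- The linearised system (L) in `(δu, δp, δS̃, δṼ) := (a, d, t·c, t·e)`, `δS̃' = c + t·dc`, `δṼ' = e + t·de`:
from `L_R = L_D = L_A = L_P = 0` (t ≠ 0) one gets
`δu' = (2/t)δu + (4/(3t))(δp - δS̃)`, `δp' = (2/t)δS̃`, `δS̃' = (4t/3)δu + (2/t)δS̃ + (4/(3t))δṼ`, `δṼ' = -3tδu`. -/
theorem innerConn_L {t a e c d da de dc dd : ℝ} (ht : t ≠ 0)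
    (hR : -(3 * t / 2) * da - 2 * t * c + 2 * d + 3 * a = 0) (hD : t * de + 3 * t * a + e = 0)
    (hA : -(3 * t ^ 2 / 2) * dc + 2 * t * e + 2 * t ^ 2 * a + 3 * t / 2 * c = 0) (hP : t * dd - 2 * t * c = 0) :
    da = 2 / t * a + 4 / (3 * t) * (d - t * c) ∧ dd = 2 / t * (t * c)
      ∧ c + t * dc = 4 * t / 3 * a + 2 / t * (t * c) + 4 / (3 * t) * (t * e) ∧ e + t * de = -3 * t * a := by
  have ht' : -(3 * t / 2) ≠ 0 := by
    intro h; apply ht; linarith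
  refine ⟨?_, ?_, ?_, ?_⟩
  · have key : -(3 * t / 2) * (da - (2 / t * a + 4 / (3 * t) * (d - t * c)))
        = -(3 * t / 2) * da - 2 * t * c + 2 * d + 3 * a := by
      field_simp
      ring
    rw [hR] at key
    rcases mul_eq_zero.mp key with h | h
    · exact absurd h ht'
    · linarith
  · have key : t * (dd - 2 / t * (t * c)) = t * dd - 2 * t * c := by
      field_simp
    rw [hP] at key
    rcases mul_eq_zero.mp key with h | h
    · exact absurd h ht
    · linarith
  · have key : -(3 * t / 2) * (c + t * dc - (4 * t / 3 * a + 2 / t * (t * c) + 4 / (3 * t) * (t * e)))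
        = -(3 * t ^ 2 / 2) * dc + 2 * t * e + 2 * t ^ 2 * a + 3 * t / 2 * c := by
      field_simp
      ring
    rw [hA] at key
    rcases mul_eq_zero.mp key with h | h
    · exact absurd h ht'
    · linarith
  · linear_combination hD

/-! ### Elimination to the CORE equation (`τ = t²`, `d/dt = 2t d/dτ`) -/

/-- First equation of (L), multiplied by `3t`, with `δu = -(2/3)f₁`, `δu' = -(4t/3)f₂`, `δp = g`, `δS̃ = τ g₁`
(`fₖ, gₖ` = τ-derivatives, `τ = t²`): `3t·[-(4t/3)f₂] = 3t·[(2/t)(-(2/3)f₁) + (4/(3t))(g - τg₁)]` is `(E1′) -τ f₂ + f₁ = g - τ g₁`. -/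
theorem innerConn_elim₁ (t f₁ f₂ g g₁ : ℝ) :
    -(4 * t ^ 2) * f₂ = -4 * f₁ + 4 * (g - t ^ 2 * g₁) ↔ -(t ^ 2) * f₂ + f₁ = g - t ^ 2 * g₁ := by
  constructor
  · intro h
    linear_combination (1 / 4 : ℝ) * h
  · intro h
    linear_combination (4 : ℝ) * h

/-- Third equation of (L), multiplied by `t/2`, with `δS̃ = τ g₁`, `δS̃' = 2t(g₁ + τ g₂)`, `δu = -(2/3)f₁`, `δṼ = f`:
`(t/2)·2t(g₁ + τg₂) = (t/2)·[(4t/3)(-(2/3)f₁) + (2/t)τg₁ + (4/(3t))f]` is `(E2′) τ² g₂ = -(4/9)τ f₁ + (2/3) f`. -/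
theorem innerConn_elim₂ (t f f₁ g₁ g₂ : ℝ) :
    t ^ 2 * g₁ + t ^ 2 * t ^ 2 * g₂ = -(4 / 9) * t ^ 2 * f₁ + t ^ 2 * g₁ + 2 / 3 * f
      ↔ (t ^ 2) ^ 2 * g₂ = -(4 / 9) * t ^ 2 * f₁ + 2 / 3 * f := by
  constructor
  · intro h
    linear_combination h
  · intro h
    linear_combination h

/-- The multipliers used above are harmless: `(2/t)(τ g₁) = 2t g₁` and `(4/(3t)) f · (t/2) = (2/3) f` for `t ≠ 0`. -/
theorem innerConn_elim_aux {t g₁ f : ℝ} (ht : t ≠ 0) :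
    2 / t * (t ^ 2 * g₁) = 2 * t * g₁ ∧ 4 / (3 * t) * f * (t / 2) = 2 / 3 * f := by
  constructor
  · field_simp
  · field_simp
    ring

/-- (E1′) says `(f₁/τ - g/τ)' = 0`: with `g = f₁ - C₁τ` (so `g₂ = f₃`) equation (E2′) is the CORE equation
`τ² f₃ + (4/9) τ f₁ - (2/3) f = 0`. -/
theorem innerConn_core {τ f f₁ f₃ g₂ : ℝ} (hg : g₂ = f₃)
    (hE2 : τ ^ 2 * g₂ = -(4 / 9) * τ * f₁ + 2 / 3 * f) :
    τ ^ 2 * f₃ + 4 / 9 * τ * f₁ - 2 / 3 * f = 0 := by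
  subst hg
  linear_combination hE2

/-- (E1′) is literally the derivative of `f₁/τ - g/τ`: `-τ²·(f₁/τ - g/τ)' = (-τ f₂ + f₁) - (g - τ g₁)`. -/
theorem innerConn_E1_exact {τ f₁ f₂ g g₁ : ℝ} (hτ : τ ≠ 0) :
    -(τ ^ 2) * ((f₂ * τ - f₁) / τ ^ 2 - (g₁ * τ - g) / τ ^ 2) = (-τ * f₂ + f₁) - (g - τ * g₁) := by
  field_simp
  ring

/-! ### The formal solutions at `τ = ∞` -/

/-- `θ(θ-1)(θ-2)τ^{μ} = μ(μ-1)(μ-2)τ^{μ}` against `-(4/9)τ(θ-3/2)τ^{μ-1} = -(4/9)(μ-5/2)τ^{μ}`: the algebraic series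
`Σ aₙ τ^{3/2-n}` has `aₙ(3/2-n)(1/2-n)(-1/2-n) = (4/9)(n+1)aₙ₊₁`. With `a₀ = 3/2`: `a₁ = -81/64`, `a₂ = -2187/4096`,
`a₁/a₀ = -27/32`, `a₂/a₀ = -729/2048`. -/
theorem innerConn_recursion :
    let a₀ : ℝ := 3 / 2
    let a₁ : ℝ := -81 / 64
    let a₂ : ℝ := -2187 / 4096
    a₀ * (3 / 2 - 0) * (1 / 2 - 0) * (-1 / 2 - 0) = 4 / 9 * (0 + 1) * a₁
      ∧ a₁ * (3 / 2 - 1) * (1 / 2 - 1) * (-1 / 2 - 1) = 4 / 9 * (1 + 1) * a₂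
      ∧ a₁ / a₀ = -27 / 32 ∧ a₂ / a₀ = -729 / 2048 := by
  norm_num

/-- MATCHING (Prop. 8.25(d)). From `f = a₀τ^{3/2} + a₁τ^{1/2} + …` (`τ = t²`): `δṼ/t = a₀t² + a₁ + …`,
`δu = -(2/3)f_τ = -a₀ t - (a₁/3)/t + …`, `δU = 2δu + 2δṼ/t² = (4/3)a₁/t + …`, `δs = τ f_ττ/t = (3/4)a₀ + …`, `δp = f_τ = (3/2)a₀ t + …`.
With `a₀ = 3/2`, `a₁ = -81/64` these are the outer slow-manifold coefficients `3/2, -81/64, -3/2, 27/64, -27/16, 9/8, 9/4`. -/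
theorem innerConn_matching :
    let a₀ : ℝ := 3 / 2
    let a₁ : ℝ := -81 / 64
    a₀ = 3 / 2 ∧ a₁ = -81 / 64 ∧ -a₀ = -3 / 2 ∧ -(a₁ / 3) = 27 / 64 ∧ 2 * (-(a₁ / 3)) + 2 * a₁ = -27 / 16
      ∧ 4 / 3 * a₁ = -27 / 16 ∧ 3 / 4 * a₀ = 9 / 8 ∧ 3 / 2 * a₀ = 9 / 4 := by
  norm_num

/-- OSCILLATORY EXPONENT. On `f = t^{2ρ} e^{iωt}`, with `θ = (t/2)d/dt` acting as `ρ + q`, `q := iωt/2`, `θq = q/2`, one has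
`θf = (ρ+q)f`, `θ²f = (q/2 + (ρ+q)²)f`, `θ³f = (q/4 + (3/2)q(ρ+q) + (ρ+q)³)f`, and `(4/9)t² = -q²` iff `ω² = 16/9`. Then
`[θ(θ-1)(θ-2) + (4/9)t²(θ - 3/2)]f / f` is the polynomial below: the `q³` terms cancel and the `q²` coefficient is `2ρ`,
so a formal solution needs `ρ = 0` — the oscillatory solutions are `O(t⁰)`. -/
theorem innerConn_osc_exponent (ρ q : ℝ) :
    (q / 4 + 3 / 2 * q * (ρ + q) + (ρ + q) ^ 3) - 3 * (q / 2 + (ρ + q) ^ 2) + 2 * (ρ + q) - q ^ 2 * (ρ + q - 3 / 2)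
      = 2 * ρ * q ^ 2 + (3 * ρ ^ 2 - 9 / 2 * ρ + 3 / 4) * q + (ρ ^ 3 - 3 * ρ ^ 2 + 2 * ρ) := by
  ring

/-! ### The Mellin–Barnes integrand: shift identities -/

/-- `s(s-1)(s-2)·Γ(-s)Γ(1-s)Γ(2-s) = -Γ(1-s)Γ(2-s)Γ(3-s)` off the poles `s = 0, 1, 2`
(three uses of `Γ(z+1) = zΓ(z)`): applying `θ(θ-1)(θ-2)` under the integral shifts the argument pattern by one. -/
theorem innerConn_MB_shift (s : ℂ) (h0 : s ≠ 0) (h1 : s ≠ 1) (h2 : s ≠ 2) :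
    s * (s - 1) * (s - 2) * (Complex.Gamma (-s) * Complex.Gamma (1 - s) * Complex.Gamma (2 - s))
      = -(Complex.Gamma (1 - s) * Complex.Gamma (2 - s) * Complex.Gamma (3 - s)) := by
  have e1 : Complex.Gamma (1 - s) = -s * Complex.Gamma (-s) := by
    have := Complex.Gamma_add_one (-s) (neg_ne_zero.mpr h0)
    rw [show -s + 1 = 1 - s by ring] at this
    rw [this]
  have e2 : Complex.Gamma (2 - s) = (1 - s) * Complex.Gamma (1 - s) := by
    have := Complex.Gamma_add_one (1 - s) (sub_ne_zero.mpr (Ne.symm h1))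
    rw [show 1 - s + 1 = 2 - s by ring] at this
    rw [this]
  have e3 : Complex.Gamma (3 - s) = (2 - s) * Complex.Gamma (2 - s) := by
    have := Complex.Gamma_add_one (2 - s) (sub_ne_zero.mpr (Ne.symm h2))
    rw [show 2 - s + 1 = 3 - s by ring] at this
    rw [this]
  rw [e3, e2, e1]
  ring

/-- `Γ(s - 1/2) = (s - 3/2)·Γ(s - 3/2)` off `s = 3/2`: after the shift `s ↦ s + 1` the fourth factor returns to `Γ(s-3/2)`
times `(s - 3/2)`, which is the right-hand side `-x(θ - 3/2)` and cancels the pole at `3/2`. -/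
theorem innerConn_MB_halfshift (s : ℂ) (h : s ≠ 3 / 2) :
    Complex.Gamma (s - 1 / 2) = (s - 3 / 2) * Complex.Gamma (s - 3 / 2) := by
  have := Complex.Gamma_add_one (s - 3 / 2) (sub_ne_zero.mpr h)
  rw [show s - 3 / 2 + 1 = s - 1 / 2 by ring] at this
  exact this

/-! ### Gamma values and the constant -/

/-- `Γ(-1/2) = -2√π`. -/
theorem innerConn_Gamma_neg_half : Real.Gamma (-1 / 2) = -2 * Real.sqrt Real.pi := by
  have h := Real.Gamma_add_one (s := -1 / 2) (by norm_num)
  rw [show (-1 / 2 : ℝ) + 1 = 1 / 2 by norm_num, Real.Gamma_one_half_eq] at h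
  linarith

/-- `Γ(-3/2) = (4/3)√π`. -/
theorem innerConn_Gamma_neg_three_halves : Real.Gamma (-3 / 2) = 4 / 3 * Real.sqrt Real.pi := by
  have h := Real.Gamma_add_one (s := -3 / 2) (by norm_num)
  rw [show (-3 / 2 : ℝ) + 1 = -1 / 2 by norm_num, innerConn_Gamma_neg_half] at h
  linarith

/-- The leading left residue: `Γ(-3/2)Γ(-1/2)Γ(1/2) = -(8/3)π√π` (one negative factor among three). -/
theorem innerConn_residue_product :
    Real.Gamma (-3 / 2) * Real.Gamma (-1 / 2) * Real.Gamma (1 / 2) = -(8 / 3) * Real.pi * Real.sqrt Real.pi := by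
  rw [innerConn_Gamma_neg_three_halves, innerConn_Gamma_neg_half, Real.Gamma_one_half_eq]
  have hp : Real.sqrt Real.pi ^ 2 = Real.pi := Real.sq_sqrt Real.pi_pos.le
  linear_combination (-(8 / 3) * Real.sqrt Real.pi) * hp

/-- The second left residue: `Γ(-1/2)Γ(1/2)Γ(3/2)·(-1) = π√π`. -/
theorem innerConn_residue_one :
    Real.Gamma (-1 / 2) * Real.Gamma (1 / 2) * Real.Gamma (3 / 2) * (-1) = Real.pi * Real.sqrt Real.pi := by
  have h32 : Real.Gamma (3 / 2) = 1 / 2 * Real.sqrt Real.pi := by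
    have h := Real.Gamma_add_one (s := 1 / 2) (by norm_num)
    rw [show (1 / 2 : ℝ) + 1 = 3 / 2 by norm_num, Real.Gamma_one_half_eq] at h
    linarith
  rw [innerConn_Gamma_neg_half, Real.Gamma_one_half_eq, h32]
  have hp : Real.sqrt Real.pi ^ 2 = Real.pi := Real.sq_sqrt Real.pi_pos.le
  linear_combination Real.sqrt Real.pi * hp

/-- The residue at `s = 0` (up to the sign of `Γ(-s) = -1/s + …`): `Γ(1)Γ(2)Γ(-3/2) = (4/3)√π` — the value `G(0⁺)`. -/
theorem innerConn_residue_zero :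
    Real.Gamma 1 * Real.Gamma 2 * Real.Gamma (-3 / 2) = 4 / 3 * Real.sqrt Real.pi := by
  have h2 : Real.Gamma 2 = 1 := by
    rw [show (2 : ℝ) = 1 + 1 by norm_num, Real.Gamma_add_one one_ne_zero, Real.Gamma_one]
    norm_num
  rw [Real.Gamma_one, h2, innerConn_Gamma_neg_three_halves]
  ring

/-- NORMALISATION. With `x = 4τ/9`, `x^{3/2} = (8/27)τ^{3/2}` and `x^{1/2} = (2/3)τ^{1/2}` (`√(4/9) = 2/3`); the factor
`λ = -243/(128 π√π)` turns the two leading residues `-(8/3)π√π·x^{3/2} + π√π·x^{1/2}` into `(3/2)τ^{3/2} - (81/64)τ^{1/2}`. -/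
theorem innerConn_norm :
    Real.sqrt (4 / 9) = 2 / 3 ∧ (4 / 9 : ℝ) * (2 / 3) = 8 / 27
      ∧ (-243 / (128 * Real.pi * Real.sqrt Real.pi)) * (-(8 / 3) * Real.pi * Real.sqrt Real.pi) * (8 / 27) = 3 / 2
      ∧ (-243 / (128 * Real.pi * Real.sqrt Real.pi)) * (Real.pi * Real.sqrt Real.pi) * (2 / 3) = -81 / 64 := by
  have hπ : Real.pi ≠ 0 := Real.pi_pos.ne'
  have hs : Real.sqrt Real.pi ≠ 0 := (Real.sqrt_pos.mpr Real.pi_pos).ne'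
  refine ⟨?_, by norm_num, ?_, ?_⟩
  · rw [show (4 / 9 : ℝ) = (2 / 3) ^ 2 by norm_num, Real.sqrt_sq (by norm_num)]
  · field_simp
    ring
  · field_simp
    ring

/-- THE CONSTANT (Prop. 8.25(c3), Cor. 8.25′). `D(0⁺) = λ·G(0⁺) = (-243/(128π√π))·((4/3)√π) = -81/(32π)`; the polar mass defect
coefficient is `k₁ = -(1/3)·D(0⁺) = 27/(32π)`, and `M₀(z₁,σ)/M₀(z₁,0) → 4k₁/σ³ = 27/(8π)/σ³`. -/
theorem innerConn_constant :
    (-243 / (128 * Real.pi * Real.sqrt Real.pi)) * (4 / 3 * Real.sqrt Real.pi) = -81 / (32 * Real.pi)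
      ∧ -(1 / 3) * (-81 / (32 * Real.pi)) = 27 / (32 * Real.pi)
      ∧ 4 * (27 / (32 * Real.pi)) = 27 / (8 * Real.pi) ∧ (0 : ℝ) < 27 / (32 * Real.pi) := by
  have hπ : Real.pi ≠ 0 := Real.pi_pos.ne'
  have hs : Real.sqrt Real.pi ≠ 0 := (Real.sqrt_pos.mpr Real.pi_pos).ne'
  refine ⟨?_, ?_, ?_, by positivity⟩
  · field_simp
    ring
  · field_simp
    ring
  · field_simp
    ring

/-! ### Prop. 8.26: the closed linear system along the linear cone -/

/-- Along the linear cone (`s₀ = σ sin φ`, so `s₀' = s₀ cot φ` exactly) the scaled fast variable `P = s₀ δU` with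
`δU' = (2/v₀)δW - cot φ·δU` satisfies `P' = s₀'δU + s₀δU' = (2s₀/v₀)δW`: the `cot φ` terms cancel (`-Ω Q` with `Ω = 2s₀/|v₀|`). -/
theorem linCone_P_eq {s₀ c v₀ δU δW ds₀ dδU : ℝ} (hs : ds₀ = c * s₀) (hU : dδU = 2 / v₀ * δW - c * δU) :
    ds₀ * δU + s₀ * dδU = 2 * s₀ / v₀ * δW := by
  rw [hs, hU]
  ring

/-- The forcing of `δW`: with `c' = -(1 + c²)` and `δv' = 2cδv - (3/2)δU`,
`3δv + (3/2)(cδv)' = (3/2)(1 + c²)δv - (9/4)cδU` (and `1 + cot² = 1/sin²`). -/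
theorem linCone_forcing {c δv δU dc dδv : ℝ} (hc : dc = -(1 + c ^ 2)) (hv : dδv = 2 * c * δv - 3 / 2 * δU) :
    3 * δv + 3 / 2 * (dc * δv + c * dδv) = 3 / 2 * (1 + c ^ 2) * δv - 9 / 4 * c * δU := by
  rw [hc, hv]
  ring

/-- `1 + cot²φ = 1/sin²φ`. -/
theorem linCone_one_add_cot_sq {φ : ℝ} (hs : Real.sin φ ≠ 0) :
    1 + (Real.cos φ / Real.sin φ) ^ 2 = 1 / Real.sin φ ^ 2 := by
  have key := Real.sin_sq_add_cos_sq φ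
  field_simp
  linear_combination key

/-- The frequency along the linear cone: `Ω = 2s₀/|v₀| = 2σ sin φ/((3/2) sin φ cos φ) = 4σ/(3 cos φ)`. -/
theorem linCone_frequency {σ φ : ℝ} (hs : Real.sin φ ≠ 0) (hc : Real.cos φ ≠ 0) :
    2 * (σ * Real.sin φ) / (3 / 2 * Real.sin φ * Real.cos φ) = 4 * σ / (3 * Real.cos φ) := by
  field_simp
  ring

end Summit.NavierStokesRegularity.NavierStokesRegularity.Theorems
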